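import Literature.Computability.QuantumComplexity.StabilizerNormalForm
import Literature.Computability.QuantumComplexity.StabilizerSimulationGadgetProofs
import HarnessLib

/-!
# Every affine/quadratic vector is a stabilizer direction — discharge of
# `VanDenNest2010_expansion_converse` (Van den Nest 2010, §5, eq. (3), "Conversely")

Topic `Literature/Computability/QuantumComplexity`; sibling proof file of
`StabilizerNormalForm.lean` (kept separate so that the statement file keeps its import cone).
It proves, sorry-free and over the tree's operational `stabilizerStates n` (the orbit of `|0ⁿ⟩`
under the monoid generated by placed `H`, `S`, `CNOT`), the named fact

* `VanDenNest2010_expansion_converse_holds` — for a non-empty affine subspace `A ⊆ 𝔽₂ⁿ`, a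
  linear `l` and a quadratic `q = quadFun c`, some non-zero multiple of
  `Σ_{x ∈ A} i^{l(x)} (-1)^{q(x)} |x⟩` is a stabilizer state (M. Van den Nest, *Classical
  simulation of quantum computation, the Gottesman–Knill theorem, and slightly beyond*, Quantum
  Inf. Comput. 10 (2010) 258–271, §5, the sentence "Conversely, every state of the form (3) is a
  stabilizer state" after eq. (3); J. Dehaene, B. De Moor, Phys. Rev. A 68 (2003) 042318, Thm. 5),

and, in the tree's own Dehaene–De Moor language (`ApproxRankTypical.ddm`), the converse of the
tree's normal form `ApproxRankTypical.repr_of_mem_stabilizerStates`: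

* `StabilizerNormalForm.exists_smul_stabilizer_ddm` — for every system `E` of affine equations
  over `𝔽₂` and every quadratic phase function `p`, the vector `x ↦ [x ⊨ E] i^{p(x)}` is a scalar
  multiple of a stabilizer state.

## The printed argument and the road taken here

Van den Nest (§5 and App. A) and Dehaene–De Moor (§IV) obtain the converse by exhibiting a
Clifford circuit: a layer of Hadamards and `CNOT`s prepares the uniform superposition over the
affine subspace, and a diagonal layer of `S`, `Z = S²` and `CZ` gates imprints the phases
`i^{l(x)} (-1)^{q(x)}`. The same two layers are used here, with one simplification permitted by
the tree: instead of synthesising the linear part of the support by `CNOT`s (which would need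
Gaussian elimination over `𝔽₂`), the support is cut out of the *full* uniform superposition by
Pauli projections, using the tree's operational Gottesman–Knill measurement rule
`StabilizerFormalism.exists_smul_stabilizer_of_pauliProj` (`Ψ + (i^k X^a Z^b)Ψ` is a scaled
stabilizer state for every stabilizer state `Ψ`):

1. `exists_smul_stabilizer_ones`: `Σ_x |x⟩ = ∏_j (1 + X_j) |0ⁿ⟩` is a scaled stabilizer state
   (induction on the set of wires already put in superposition, `cornerVec`).
2. `IsDiag`, `isDiag_of_isQF`: every quadratic phase function `p = c + Σ lᵢ[xᵢ] + 2Σ qᵢₖ[xᵢ][xₖ]`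
   is realised, up to the constant `c`, by a *diagonal* Clifford circuit `D`,
   `D|x⟩ = i^{p(x) - c}|x⟩`: `S_j` gives `[x_j]`, and for `j ≠ k` the word
   `S_j S_k CNOT_{jk} S_k³ CNOT_{jk}` gives `2[x_j][x_k]` (i.e. `CZ_{jk}`), by the identity
   `[a] + [b] + 3[a ⊕ b] = 2[a][b]` in `ℤ₄`.
3. `projVec`, `exists_smul_stabilizer_projVec`: for an affine equation `β·x = b` the projection
   `1 + (-1)^b Z^β` doubles the amplitudes on its solutions and kills the others; iterating over
   the equations of `E` cuts the support down to `{x ⊨ E}`.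
4. `exists_smul_stabilizer_ddm` assembles 1–3; `VanDenNest2010_expansion_converse_holds` writes a
   Mathlib affine subspace `A` as the solution set of the (finitely many) functionals in the
   annihilator of its direction (`Subspace.forall_mem_dualAnnihilator_apply_eq_zero_iff`) and the
   phase `i^{l(x)} (-1)^{q(x)}` as `i^{lift l(x) + 2 lift q(x)}`, a quadratic phase function.

## References

* M. Van den Nest, *Classical simulation of quantum computation, the Gottesman–Knill theorem, and
  slightly beyond*, Quantum Inf. Comput. 10 (2010) 258–271, arXiv:0811.0898, §5 eq. (3) and
  App. A. [Vandennest2010]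
* J. Dehaene, B. De Moor, *Clifford group, stabilizer states, and linear and quadratic operations
  over GF(2)*, Phys. Rev. A 68 (2003) 042318, Thm. 5 and §IV. [DehaeneDemoor2003]
* S. Aaronson, D. Gottesman, *Improved simulation of stabilizer circuits*, Phys. Rev. A 70 (2004)
  052328, §III (measurement update rule, the source of the projection lemma). [AaronsonGottesman2004]
-/

noncomputable section

namespace Literature.Computability.QuantumComplexity

open _root_.Computability Cryptography Matrix Finset
open ApproxRankTypical
open StabilizerFormalism (pauliOp pauliOp_mulVec_apply bxor bxor_zero bxor_single sgn_zero_left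
  exists_smul_stabilizer_of_pauliProj sGate_pow_mulVec_basisState cxGate cxGate_mem
  cxGate_mulVec_basisState placeGate_sGate_mem)

namespace StabilizerNormalForm

variable {n : ℕ}

/-! ### The uniform superposition is a scaled stabilizer state -/

/-- The indicator vector of the registers vanishing outside the wire set `T`
(`T = ∅`: `|0ⁿ⟩`; `T = univ`: `Σ_x |x⟩`). [folklore] -/
def cornerVec (T : Finset (Fin n)) : QReg n → ℂ :=
  fun x => if ∀ i, i ∉ T → x i = false then 1 else 0

/-- Definitional unfolding of `cornerVec`. [folklore] -/
theorem cornerVec_apply (T : Finset (Fin n)) (x : QReg n) :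
    cornerVec T x = if ∀ i, i ∉ T → x i = false then 1 else 0 := rfl

/-- `cornerVec ∅ = |0ⁿ⟩`. [folklore] -/
theorem cornerVec_empty : cornerVec (∅ : Finset (Fin n)) = zeroState n := by
  funext x
  rw [cornerVec_apply, zeroState, basisState_apply]
  have h : (∀ i, i ∉ (∅ : Finset (Fin n)) → x i = false) ↔ x = fun _ => false :=
    ⟨fun h => funext fun i => h i (Finset.notMem_empty i), fun h i _ => by rw [h]⟩
  exact if_congr h rfl rfl

/-- `cornerVec univ = Σ_x |x⟩`, the all-ones vector. [folklore] -/
theorem cornerVec_univ : cornerVec (Finset.univ : Finset (Fin n)) = fun _ => 1 := by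
  funext x
  rw [cornerVec_apply, if_pos fun i hi => absurd (Finset.mem_univ i) hi]

/-- Adding a wire: `cornerVec (T ∪ {j}) = (1 + X_j) cornerVec T` for `j ∉ T`. [folklore] -/
theorem cornerVec_insert {T : Finset (Fin n)} {j : Fin n} (hj : j ∉ T) :
    cornerVec (insert j T) =
      cornerVec T + pauliOp (Pi.single j true) (fun _ => false) *ᵥ cornerVec T := by
  classical
  funext x
  rw [Pi.add_apply, pauliOp_mulVec_apply, sgn_zero_left, one_mul, bxor_single, cornerVec_apply,
    cornerVec_apply, cornerVec_apply]
  rcases Bool.eq_false_or_eq_true (x j) with hxj | hxj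
  · -- `x j = true`: only the flipped term survives
    have h1 : ¬ (∀ i, i ∉ T → x i = false) := fun h => by
      rw [h j hj] at hxj
      exact Bool.false_ne_true hxj
    have h2 : (∀ i, i ∉ insert j T → x i = false) ↔
        (∀ i, i ∉ T → Function.update x j (!x j) i = false) := by
      rw [hxj, Bool.not_true]
      constructor
      · intro h i hi
        by_cases hij : i = j
        · subst hij
          rw [Function.update_self]
        · rw [Function.update_of_ne hij]
          exact h i (by rw [Finset.mem_insert, not_or]; exact ⟨hij, hi⟩)
      · intro h i hi
        rw [Finset.mem_insert, not_or] at hi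
        have := h i hi.2
        rwa [Function.update_of_ne hi.1] at this
    rw [if_neg h1, zero_add]
    exact if_congr h2 rfl rfl
  · -- `x j = false`: only the unflipped term survives
    have h1 : ¬ (∀ i, i ∉ T → Function.update x j (!x j) i = false) := fun h => by
      have := h j hj
      rw [hxj, Bool.not_false, Function.update_self] at this
      exact Bool.noConfusion this
    have h2 : (∀ i, i ∉ insert j T → x i = false) ↔ (∀ i, i ∉ T → x i = false) := by
      constructor
      · intro h i hi
        by_cases hij : i = j
        · subst hij
          exact hxj
        · exact h i (by rw [Finset.mem_insert, not_or]; exact ⟨hij, hi⟩)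
      · intro h i hi
        rw [Finset.mem_insert, not_or] at hi
        exact h i hi.2
    rw [if_neg h1, add_zero]
    exact if_congr h2 rfl rfl

/-- Every `cornerVec T` is a scaled stabilizer state (`∏_{j ∈ T} (1 + X_j) |0ⁿ⟩` and the Pauli
projection rule). [folklore] -/
theorem exists_smul_stabilizer_cornerVec (T : Finset (Fin n)) :
    ∃ (c : ℂ) (Ψ : QReg n → ℂ), Ψ ∈ stabilizerStates n ∧ cornerVec T = c • Ψ := by
  classical
  induction T using Finset.induction_on with
  | empty => exact ⟨1, zeroState n, zeroState_mem_stabilizerStates n, by rw [cornerVec_empty, one_smul]⟩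
  | insert j T hj ih =>
    obtain ⟨c, Ψ, hΨ, hT⟩ := ih
    obtain ⟨c', Ψ', hΨ', h'⟩ :=
      exists_smul_stabilizer_of_pauliProj hΨ 0 (Pi.single j true) (fun _ => false)
    refine ⟨c * c', Ψ', hΨ', ?_⟩
    rw [pow_zero, one_smul] at h'
    rw [cornerVec_insert hj, hT, Matrix.mulVec_smul, ← smul_add, h', smul_smul]

/-- **The uniform superposition `Σ_x |x⟩` is a scaled stabilizer state** (it is
`√2ⁿ H^{⊗n} |0ⁿ⟩`; here obtained as `∏_j (1 + X_j)|0ⁿ⟩`). [folklore] -/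
theorem exists_smul_stabilizer_ones :
    ∃ (c : ℂ) (Ψ : QReg n → ℂ), Ψ ∈ stabilizerStates n ∧ (fun _ : QReg n => (1 : ℂ)) = c • Ψ := by
  rw [← cornerVec_univ]
  exact exists_smul_stabilizer_cornerVec _

/-! ### Diagonal Clifford circuits realising quadratic phase functions -/

/-- `f : 𝔽₂ⁿ → ℤ₄` is *diagonally realisable*: some Clifford circuit acts on basis states as
`|x⟩ ↦ i^{f(x)} |x⟩`. [folklore] -/
def IsDiag (f : QReg n → ZMod 4) : Prop :=
  ∃ D ∈ cliffordCircuits n, ∀ x, D *ᵥ basisState x = phase (f x) • basisState x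

namespace IsDiag

/-- `IsDiag` is extensional. [folklore] -/
theorem congr {f g : QReg n → ZMod 4} (h : IsDiag f) (e : ∀ x, f x = g x) : IsDiag g := by
  obtain ⟨D, hD, hf⟩ := h
  exact ⟨D, hD, fun x => by rw [← e x, hf x]⟩

/-- The zero phase function (empty circuit). [folklore] -/
theorem zero : IsDiag (fun _ : QReg n => (0 : ZMod 4)) :=
  ⟨1, Submonoid.one_mem _, fun x => by rw [Matrix.one_mulVec, phase_zero, one_smul]⟩

/-- Sums: compose the circuits. [folklore] -/
theorem add {f g : QReg n → ZMod 4} (hf : IsDiag f) (hg : IsDiag g) :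
    IsDiag (fun x => f x + g x) := by
  obtain ⟨D, hD, hf⟩ := hf
  obtain ⟨D', hD', hg⟩ := hg
  refine ⟨D * D', Submonoid.mul_mem _ hD hD', fun x => ?_⟩
  rw [← Matrix.mulVec_mulVec, hg, Matrix.mulVec_smul, hf, smul_smul, phase_add, mul_comm]

/-- Natural multiples: iterate the circuit. [folklore] -/
theorem nsmul {f : QReg n → ZMod 4} (hf : IsDiag f) : ∀ m : ℕ, IsDiag (fun x => (m : ZMod 4) * f x)
  | 0 => zero.congr fun x => by simp
  | m + 1 => ((nsmul hf m).add hf).congr fun x => by push_cast; ring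

/-- Multiples by `a ∈ ℤ₄`. [folklore] -/
theorem smul (a : ZMod 4) {f : QReg n → ZMod 4} (hf : IsDiag f) : IsDiag (fun x => a * f x) :=
  (hf.nsmul a.val).congr fun x => by rw [ZMod.natCast_zmod_val]

/-- Finite sums. [folklore] -/
theorem sum {ι : Type*} (s : Finset ι) (F : ι → QReg n → ZMod 4) (h : ∀ i ∈ s, IsDiag (F i)) :
    IsDiag (fun x => ∑ i ∈ s, F i x) := by
  classical
  induction s using Finset.induction_on with
  | empty => exact zero.congr fun x => by simp
  | insert a s ha ih =>
    have := (h a (Finset.mem_insert_self a s)).add (ih fun i hi => h i (Finset.mem_insert_of_mem hi))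
    refine this.congr fun x => ?_
    rw [Finset.sum_insert ha]

/-- The coordinate phase `[x_j]` is realised by `S_j`. [folklore] -/
theorem coord (j : Fin n) : IsDiag (fun x : QReg n => bq (x j)) := by
  refine ⟨placeGate (wireEmb j) sGate, placeGate_sGate_mem j, fun x => ?_⟩
  have h := sGate_pow_mulVec_basisState j 1 x
  rw [pow_one, pow_one] at h
  rw [h, phase_bq]

end IsDiag

/-- `[b]² = [b]` in `ℤ₄`. [folklore] -/
theorem bq_mul_self (b : Bool) : bq b * bq b = bq b := by cases b <;> decide

/-- The `CZ` identity in `ℤ₄`: `3[b ⊕ a] + [b] + [a] = 2[a][b]`. [folklore] -/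
theorem three_mul_bq_xor_add (a b : Bool) :
    3 * bq (b ^^ a) + bq b + bq a = 2 * (bq a * bq b) := by
  cases a <;> cases b <;> decide

/-- `(i^{[b]})³ = i^{3[b]}`. [folklore] -/
theorem ite_I_pow_three (b : Bool) : (if b then Complex.I else 1) ^ 3 = phase (3 * bq b) := by
  rw [phase_three_mul_bq]
  cases b
  · simp
  · simp only [if_true]
    rw [pow_succ, Complex.I_sq]
    ring

/-- `CNOT_{j→k}` on a basis state, as an update of the target bit (`j ≠ k`). [folklore] -/
theorem cxGate_mulVec_basisState_of_ne {j k : Fin n} (hjk : j ≠ k) (w : QReg n) :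
    cxGate j k *ᵥ basisState w = basisState (Function.update w k (w k ^^ w j)) := by
  rw [cxGate_mulVec_basisState]
  rcases Bool.eq_false_or_eq_true (w j) with h | h
  · rw [if_pos ⟨hjk.symm, h⟩, h, Bool.xor_true]
  · rw [if_neg (fun h' => by rw [h] at h'; exact Bool.false_ne_true h'.2), h, Bool.xor_false,
      Function.update_eq_self]

/-- **The `CZ` phase `2[x_j][x_k]` (`j ≠ k`) is realised by `S_j S_k CNOT_{jk} S_k³ CNOT_{jk}`.**
[folklore] -/
theorem isDiag_two_mul_coord_mul_coord_of_ne {j k : Fin n} (hjk : j ≠ k) :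
    IsDiag (fun x : QReg n => 2 * (bq (x j) * bq (x k))) := by
  refine ⟨placeGate (wireEmb j) sGate * placeGate (wireEmb k) sGate * cxGate j k *
      placeGate (wireEmb k) sGate ^ 3 * cxGate j k, ?_, fun x => ?_⟩
  · exact Submonoid.mul_mem _ (Submonoid.mul_mem _ (Submonoid.mul_mem _ (Submonoid.mul_mem _
      (placeGate_sGate_mem j) (placeGate_sGate_mem k)) (cxGate_mem j k))
      (Submonoid.pow_mem _ (placeGate_sGate_mem k) 3)) (cxGate_mem j k)
  · set x₁ := Function.update x k (x k ^^ x j) with hx₁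
    have hx₁k : x₁ k = (x k ^^ x j) := by rw [hx₁, Function.update_self]
    have hx₁j : x₁ j = x j := by rw [hx₁, Function.update_of_ne hjk]
    have hback : Function.update x₁ k (x₁ k ^^ x₁ j) = x := by
      rw [hx₁k, hx₁j, Bool.xor_assoc, Bool.xor_self, Bool.xor_false, hx₁, Function.update_idem,
        Function.update_eq_self]
    have hS1 : ∀ (i : Fin n) (w : QReg n), placeGate (wireEmb i) sGate *ᵥ basisState w =
        phase (bq (w i)) • basisState w := by
      intro i w
      have h := sGate_pow_mulVec_basisState i 1 w
      rw [pow_one, pow_one] at h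
      rw [h, phase_bq]
    rw [← Matrix.mulVec_mulVec, ← Matrix.mulVec_mulVec, ← Matrix.mulVec_mulVec,
      ← Matrix.mulVec_mulVec, cxGate_mulVec_basisState_of_ne hjk, ← hx₁,
      sGate_pow_mulVec_basisState, Matrix.mulVec_smul, cxGate_mulVec_basisState_of_ne hjk, hback,
      Matrix.mulVec_smul, hS1 k, Matrix.mulVec_smul, Matrix.mulVec_smul, hS1 j, smul_smul, smul_smul,
      ite_I_pow_three, hx₁k, ← phase_add, ← phase_add, three_mul_bq_xor_add]

/-- The phase `2[x_j][x_k]` is diagonally realisable for all `j, k` (for `j = k` it is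
`2[x_j]`, i.e. `Z_j = S_j²`). [folklore] -/
theorem isDiag_two_mul_coord_mul_coord (j k : Fin n) :
    IsDiag (fun x : QReg n => 2 * (bq (x j) * bq (x k))) := by
  by_cases hjk : j = k
  · subst hjk
    exact ((IsDiag.coord j).smul 2).congr fun x => by rw [bq_mul_self]
  · exact isDiag_two_mul_coord_mul_coord_of_ne hjk

/-- **Every quadratic phase function is diagonally realisable up to its constant term**
(the `S`/`Z`/`CZ` layer of the stabilizer-state preparation circuit).
[Dehaene–De Moor 2003, §IV; Van den Nest 2010, App. A] [folklore] -/
theorem isDiag_of_isQF {p : QReg n → ZMod 4} (hp : IsQF p) :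
    ∃ c : ZMod 4, IsDiag (fun x => p x + c) := by
  classical
  obtain ⟨c, l, q, hp⟩ := hp
  refine ⟨-c, ?_⟩
  have h1 : IsDiag (fun x => ∑ i, l i * bq (x i)) :=
    IsDiag.sum _ (fun i x => l i * bq (x i)) fun i _ => (IsDiag.coord i).smul (l i)
  have h2 : IsDiag (fun x => ∑ i, ∑ k, q i k * (2 * (bq (x i) * bq (x k)))) :=
    IsDiag.sum _ (fun i x => ∑ k, q i k * (2 * (bq (x i) * bq (x k)))) fun i _ =>
      IsDiag.sum _ (fun k x => q i k * (2 * (bq (x i) * bq (x k)))) fun k _ =>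
        (isDiag_two_mul_coord_mul_coord i k).smul (q i k)
  refine (h1.add h2).congr fun x => ?_
  have e2 : ∑ i, ∑ k, q i k * (2 * (bq (x i) * bq (x k))) =
      2 * ∑ i, ∑ k, q i k * (bq (x i) * bq (x k)) := by
    rw [Finset.mul_sum]
    refine Finset.sum_congr rfl fun i _ => ?_
    rw [Finset.mul_sum]
    exact Finset.sum_congr rfl fun k _ => by ring
  rw [hp x, e2]
  ring

/-- A matrix that is diagonal on basis states acts pointwise on every vector. [folklore] -/
theorem mulVec_eq_of_basisState {D : Matrix (QReg n) (QReg n) ℂ} {φ : QReg n → ℂ}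
    (h : ∀ x, D *ᵥ basisState x = φ x • basisState x) (v : QReg n → ℂ) :
    D *ᵥ v = fun x => φ x * v x := by
  have hD : ∀ x y, D x y = if x = y then φ y else 0 := by
    intro x y
    have := congrFun (h y) x
    rw [mulVec_basisState] at this
    simp only [Pi.smul_apply, basisState_apply, smul_eq_mul, mul_ite, mul_one, mul_zero] at this
    exact this
  funext x
  rw [Matrix.mulVec, dotProduct]
  simp_rw [hD]
  simp only [ite_mul, zero_mul, Finset.sum_ite_eq, Finset.mem_univ, if_true]

/-! ### Cutting out the support by Pauli `Z`-projections -/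

/-- The `𝔽₂` pairing `β · x = Σ βᵢ xᵢ` of two bit strings. [folklore] -/
def dotz (β x : QReg n) : ZMod 2 := ∑ i, bz (β i) * bz (x i)

/-- `(-1)^{u+v} = (-1)^u (-1)^v` for the character `z ↦ (-1)^z` of `𝔽₂`, written as an `if`.
[folklore] -/
theorem ite_add_eq_zero_eq_mul (u v : ZMod 2) :
    (if u + v = 0 then (1 : ℂ) else -1) = (if u = 0 then (1 : ℂ) else -1) * (if v = 0 then 1 else -1) := by
  have hu : u = 0 ∨ u = 1 := by revert u; decide
  have hv : v = 0 ∨ v = 1 := by revert v; decide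
  rcases hu with rfl | rfl <;> rcases hv with rfl | rfl
  · simp
  · simp
  · simp
  · simp only [show (1 : ZMod 2) + 1 = 0 from by decide, if_true, one_ne_zero, if_false]
    ring

/-- One factor of the sign: `(-1)^{[a][b]}`. [folklore] -/
theorem ite_bz_mul_bz_eq_zero (a b : Bool) :
    (if bz a * bz b = 0 then (1 : ℂ) else -1) = if (a && b) then -1 else 1 := by
  cases a <;> cases b <;> simp

/-- The sign of `Z^β` on `|x⟩` is `(-1)^{β·x}`. [folklore] -/
theorem sgn_eq_ite_dotz (β x : QReg n) :
    StabilizerFormalism.sgn β x = if dotz β x = 0 then 1 else -1 := by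
  classical
  unfold StabilizerFormalism.sgn dotz
  suffices h : ∀ s : Finset (Fin n), ∏ i ∈ s, (if (β i && x i) then (-1 : ℂ) else 1) =
      if (∑ i ∈ s, bz (β i) * bz (x i)) = 0 then 1 else -1 from h Finset.univ
  intro s
  induction s using Finset.induction_on with
  | empty => simp
  | insert a s ha ih =>
    rw [Finset.prod_insert ha, Finset.sum_insert ha, ite_add_eq_zero_eq_mul, ih, ite_bz_mul_bz_eq_zero]

/-- **One projection.** For an affine equation `β·x = b`, the operator `1 + (-1)^b Z^β`
(`(-1)^b = i^{2b}`) doubles the amplitudes on the solutions and kills the others. [folklore] -/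
theorem proj_apply (β : QReg n) (b : Bool) (v : QReg n → ℂ) (x : QReg n) :
    (v + (Complex.I ^ (if b then 2 else 0) • pauliOp (fun _ => false) β) *ᵥ v) x =
      if dotz β x = bz b then 2 * v x else 0 := by
  rw [Pi.add_apply, Matrix.smul_mulVec, Pi.smul_apply, pauliOp_mulVec_apply, bxor_zero,
    sgn_eq_ite_dotz, smul_eq_mul]
  have hd : dotz β x = 0 ∨ dotz β x = 1 := by generalize dotz β x = z; revert z; decide
  rcases hd with hd | hd <;> cases b
  · simp [hd]; ring
  · simp [hd]
  · simp only [hd, one_ne_zero, if_false, Bool.false_eq_true, pow_zero, bz_false]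
    ring
  · simp only [hd, one_ne_zero, if_false, if_true, Complex.I_sq, bz_true]
    ring

/-- The iterated projection onto the solutions of a list of affine equations `β·x = b`,
with the accumulated factor `2^{|L|}`. [folklore] -/
def projVec (L : List (QReg n × Bool)) (v : QReg n → ℂ) : QReg n → ℂ :=
  fun x => if ∀ e ∈ L, dotz e.1 x = bz e.2 then (2 : ℂ) ^ L.length * v x else 0

/-- Definitional unfolding of `projVec`. [folklore] -/
theorem projVec_apply (L : List (QReg n × Bool)) (v : QReg n → ℂ) (x : QReg n) :
    projVec L v x = if ∀ e ∈ L, dotz e.1 x = bz e.2 then (2 : ℂ) ^ L.length * v x else 0 := rfl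

/-- No equation: nothing happens. [folklore] -/
theorem projVec_nil (v : QReg n → ℂ) : projVec [] v = v := by
  funext x
  simp [projVec_apply]

/-- One more equation: one more projection. [folklore] -/
theorem projVec_cons (β : QReg n) (b : Bool) (L : List (QReg n × Bool)) (v : QReg n → ℂ) :
    projVec ((β, b) :: L) v = projVec L v +
      (Complex.I ^ (if b then 2 else 0) • pauliOp (fun _ => false) β) *ᵥ projVec L v := by
  funext x
  rw [proj_apply, projVec_apply, projVec_apply]
  simp only [List.mem_cons, forall_eq_or_imp, List.length_cons, pow_succ]
  by_cases h1 : dotz β x = bz b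
  · rw [if_pos h1]
    by_cases h2 : ∀ e ∈ L, dotz e.1 x = bz e.2
    · rw [if_pos ⟨h1, h2⟩, if_pos h2]; ring
    · rw [if_neg (fun h => h2 h.2), if_neg h2, mul_zero]
  · rw [if_neg h1, if_neg (fun h => h1 h.1)]

/-- **Projections preserve scaled stabilizer states.** [cite: AaronsonGottesman2004, §III] -/
theorem exists_smul_stabilizer_projVec (L : List (QReg n × Bool)) {v : QReg n → ℂ}
    (hv : ∃ (c : ℂ) (Ψ : QReg n → ℂ), Ψ ∈ stabilizerStates n ∧ v = c • Ψ) :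
    ∃ (c : ℂ) (Ψ : QReg n → ℂ), Ψ ∈ stabilizerStates n ∧ projVec L v = c • Ψ := by
  induction L with
  | nil => rwa [projVec_nil]
  | cons e L ih =>
    obtain ⟨β, b⟩ := e
    obtain ⟨c, Ψ, hΨ, hL⟩ := ih
    obtain ⟨c', Ψ', hΨ', h'⟩ :=
      exists_smul_stabilizer_of_pauliProj hΨ (if b then 2 else 0) (fun _ => false) β
    refine ⟨c * c', Ψ', hΨ', ?_⟩
    rw [projVec_cons, hL, Matrix.mulVec_smul, ← smul_add, h', smul_smul]

/-- The list of `(β, b)`-pairs of a system of affine equations. [folklore] -/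
def eqList (E : List (AffEq n)) : List (QReg n × Bool) :=
  E.map fun e : AffEq n => (fun i => ApproxRankTypical.toBool (e.α i), ApproxRankTypical.toBool e.b)

/-- In characteristic two, `b + s = 0 ↔ s = b`. [folklore] -/
theorem add_eq_zero_iff_eq (b s : ZMod 2) : b + s = 0 ↔ s = b := by revert b s; decide

/-- The projections of `eqList E` cut out exactly the solutions of `E`. [folklore] -/
theorem forall_eqList_iff (E : List (AffEq n)) (x : QReg n) :
    (∀ e ∈ eqList E, dotz e.1 x = bz e.2) ↔ Sol E x := by
  simp only [eqList, List.forall_mem_map, Sol, AffEq.eval, dotz, bz_toBool, add_eq_zero_iff_eq]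

/-- **Converse of the Dehaene–De Moor normal form**: for every system `E` of affine equations
over `𝔽₂` and every quadratic phase function `p`, the vector `x ↦ [x ⊨ E] · i^{p(x)}` is a
scalar multiple of a stabilizer state. [Dehaene–De Moor 2003, Thm. 5; Van den Nest 2010, §5]
[cite: Vandennest2010, §5 eq. (3) (Conversely)] -/
theorem exists_smul_stabilizer_ddm (E : List (AffEq n)) {p : QReg n → ZMod 4} (hp : IsQF p) :
    ∃ (c : ℂ) (Ψ : QReg n → ℂ), Ψ ∈ stabilizerStates n ∧ ddm E p 1 = c • Ψ := by
  obtain ⟨c₀, D, hD, hDact⟩ := isDiag_of_isQF hp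
  obtain ⟨c₁, Ψ₁, hΨ₁, hones⟩ := exists_smul_stabilizer_ones (n := n)
  -- the phase layer
  have hphase : (fun x => phase (p x)) = ((phase c₀)⁻¹ * c₁) • (D *ᵥ Ψ₁) := by
    have h1 : D *ᵥ (fun _ : QReg n => (1 : ℂ)) = fun x => phase (p x + c₀) :=
      (mulVec_eq_of_basisState hDact _).trans (funext fun x => mul_one _)
    rw [hones, Matrix.mulVec_smul] at h1
    rw [mul_smul, h1]
    funext x
    rw [Pi.smul_apply, smul_eq_mul, phase_add, mul_comm (phase (p x)), ← mul_assoc,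
      inv_mul_cancel₀ (phase_ne_zero c₀), one_mul]
  -- the projections
  obtain ⟨c₂, Ψ₂, hΨ₂, hproj⟩ := exists_smul_stabilizer_projVec (eqList E)
    ⟨(phase c₀)⁻¹ * c₁, D *ᵥ Ψ₁, mulVec_mem_stabilizerStates hD hΨ₁, hphase⟩
  have hlen : ((2 : ℂ) ^ (eqList E).length) ≠ 0 := pow_ne_zero _ two_ne_zero
  refine ⟨((2 : ℂ) ^ (eqList E).length)⁻¹ * c₂, Ψ₂, hΨ₂, ?_⟩
  rw [mul_smul, ← hproj]
  funext x
  rw [ddm_apply, Pi.smul_apply, projVec_apply, smul_eq_mul, one_mul]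
  by_cases hs : Sol E x
  · rw [if_pos hs, if_pos ((forall_eqList_iff E x).2 hs), ← mul_assoc, inv_mul_cancel₀ hlen, one_mul]
  · rw [if_neg hs, if_neg (fun h => hs ((forall_eqList_iff E x).1 h)), mul_zero]

/-! ### From Mathlib affine subspaces and linear/quadratic forms to the normal form -/

/-- The standard basis vector `e_i` of `𝔽₂ⁿ` (in the form used by `LinearMap.pi_apply_eq_sum_univ`).
[folklore] -/
def unitV (i : Fin n) : V n := fun j => if i = j then 1 else 0

/-- A linear functional on `𝔽₂ⁿ` in coordinates: `f v = Σᵢ f(eᵢ) vᵢ`. [folklore] -/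
theorem dual_apply_eq_sum (f : Module.Dual (ZMod 2) (V n)) (v : V n) :
    f v = ∑ i, f (unitV i) * v i := by
  rw [LinearMap.pi_apply_eq_sum_univ f v]
  exact Finset.sum_congr rfl fun i _ => by rw [smul_eq_mul, mul_comm]; rfl

/-- `2[u + v] = 2[u] + 2[v]` in `ℤ₄`. [folklore] -/
theorem two_mul_lift_add (u v : ZMod 2) : 2 * lift (u + v) = 2 * lift u + 2 * lift v := by
  revert u v; decide

/-- `2[u v] = 2[u][v]` in `ℤ₄`. [folklore] -/
theorem two_mul_lift_mul (u v : ZMod 2) : 2 * lift (u * v) = 2 * lift u * lift v := by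
  revert u v; decide

/-- `2[Σ g] = Σ 2[g]` in `ℤ₄`. [folklore] -/
theorem two_mul_lift_sum {ι : Type*} (s : Finset ι) (g : ι → ZMod 2) :
    2 * lift (∑ i ∈ s, g i) = ∑ i ∈ s, 2 * lift (g i) := by
  classical
  induction s using Finset.induction_on with
  | empty => simp [lift]
  | insert a s ha ih => rw [Finset.sum_insert ha, Finset.sum_insert ha, two_mul_lift_add, ih]

/-- `i^{[z]}` for `z ∈ 𝔽₂` is `i^{z.val}`. [folklore] -/
theorem phase_lift (z : ZMod 2) : phase (lift z) = Complex.I ^ z.val := by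
  have hz : z = 0 ∨ z = 1 := by revert z; decide
  rcases hz with rfl | rfl
  · rw [show lift (0 : ZMod 2) = 0 from by decide, phase_zero, ZMod.val_zero, pow_zero]
  · rw [show lift (1 : ZMod 2) = 1 from by decide, phase, show (1 : ZMod 4).val = 1 from rfl,
      show (1 : ZMod 2).val = 1 from rfl]

/-- `i^{2[z]} = (-1)^{z.val}` for `z ∈ 𝔽₂`. [folklore] -/
theorem phase_two_mul_lift (z : ZMod 2) : phase (2 * lift z) = (-1 : ℂ) ^ z.val := by
  have hz : z = 0 ∨ z = 1 := by revert z; decide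
  rcases hz with rfl | rfl
  · rw [show 2 * lift (0 : ZMod 2) = 0 from by decide, phase_zero, ZMod.val_zero, pow_zero]
  · rw [show 2 * lift (1 : ZMod 2) = 2 * bq true from by decide, phase_two_mul_bq, if_pos rfl,
      show (1 : ZMod 2).val = 1 from rfl, pow_one]

/-- The register label with given `𝔽₂`-coordinates. [folklore] -/
def ofV (v : V n) : QReg n := fun i => ApproxRankTypical.toBool (v i)

/-- `[toV x i] = [x i]` in `ℤ₄`. [folklore] -/
theorem lift_toV (x : QReg n) (i : Fin n) : lift (toV x i) = bq (x i) := lift_bz (x i)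

/-- `toV ∘ ofV = id`. [folklore] -/
@[simp] theorem toV_ofV (v : V n) : toV (ofV v) = v := funext fun i => bz_toBool (v i)

/-- `ofV ∘ toV = id`. [folklore] -/
@[simp] theorem ofV_toV (x : QReg n) : ofV (toV x) = x := funext fun i => toBool_bz (x i)

/-- **The phase `i^{l(x)} (-1)^{q(x)}` of Van den Nest's eq. (3) is a quadratic phase function**:
`x ↦ [l(x)] + 2[q(x)]`. [cite: Vandennest2010, §5 eq. (3)] -/
theorem isQF_lift_add_two_mul_lift (l : (V n) →ₗ[ZMod 2] ZMod 2) (c : Fin n → Fin n → ZMod 2) :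
    IsQF (fun x : QReg n => lift (l (toV x)) + 2 * lift (quadFun c (toV x))) := by
  classical
  have h1 : IsQF (fun x : QReg n => lift (l (toV x))) := by
    refine (IsQF.lift_affine (fun i => l (unitV i)) 0).congr fun x => ?_
    rw [zero_add, dual_apply_eq_sum]
    rfl
  have h2 : IsQF (fun x : QReg n => 2 * lift (quadFun c (toV x))) := by
    have : IsQF (fun x : QReg n => ∑ i, ∑ j, lift (c i j) * (2 * bq (x i) * bq (x j))) :=
      IsQF.sum _ (fun i x => ∑ j, lift (c i j) * (2 * bq (x i) * bq (x j))) fun i _ =>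
        IsQF.sum _ (fun j x => lift (c i j) * (2 * bq (x i) * bq (x j))) fun j _ =>
          ((IsQF.coord i).two_mul_mul (IsQF.coord j)).smul (lift (c i j))
    refine this.congr fun x => ?_
    rw [quadFun, two_mul_lift_sum]
    refine Finset.sum_congr rfl fun i _ => ?_
    rw [two_mul_lift_sum]
    refine Finset.sum_congr rfl fun j _ => ?_
    rw [two_mul_lift_mul, two_mul_lift_mul, lift_toV, lift_toV]
    ring
  exact h1.add h2

/-- The system of affine equations `f(x) = f(a₀)`, `f` ranging over a finite set of functionals.
[folklore] -/
def eqsOf (T : Finset (Module.Dual (ZMod 2) (V n))) (a₀ : V n) : List (AffEq n) :=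
  T.toList.map fun f => ⟨fun i => f (unitV i), f a₀⟩

/-- `x` solves `eqsOf T a₀` iff every `f ∈ T` takes the same value at `x` and `a₀`. [folklore] -/
theorem sol_eqsOf_iff (T : Finset (Module.Dual (ZMod 2) (V n))) (a₀ : V n) (x : QReg n) :
    Sol (eqsOf T a₀) x ↔ ∀ f ∈ T, f (toV x) = f a₀ := by
  rw [eqsOf, sol_map]
  simp only [Finset.mem_toList, AffEq.eval, add_eq_zero_iff_eq]
  refine forall₂_congr fun f _ => ?_
  rw [dual_apply_eq_sum f (toV x)]
  rfl

/-- **Discharge of `VanDenNest2010_expansion_converse`** (Van den Nest 2010, §5, the sentence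
after eq. (3): "Conversely, every state of the form (3) is a stabilizer state"; Dehaene–De Moor
2003, Thm. 5): for a non-empty affine subspace `A ⊆ 𝔽₂ⁿ`, a linear form `l` and a quadratic
form `q = quadFun c`, a non-zero multiple of `Σ_{x ∈ A} i^{l(x)} (-1)^{q(x)} |x⟩` lies in the
Clifford orbit of `|0ⁿ⟩`. Proof: `A` is the solution set of the equations `f(x) = f(a₀)` for `f`
in the annihilator of its direction, the phase is the quadratic phase function
`[l(x)] + 2[q(x)]`, and `exists_smul_stabilizer_ddm` applies.
[cite: Vandennest2010, §5 eq. (3) (Conversely)] -/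
theorem _root_.Literature.Computability.QuantumComplexity.VanDenNest2010_expansion_converse_holds :
    VanDenNest2010_expansion_converse := by
  classical
  intro n A l c hA
  obtain ⟨a₀, ha₀⟩ := hA
  have ha₀' : a₀ ∈ A := ha₀
  haveI : Finite (Module.Dual (ZMod 2) (V n)) := Module.finite_of_finite (ZMod 2)
  -- the equations of `A`
  set T : Finset (Module.Dual (ZMod 2) (V n)) :=
    (Set.toFinite (A.direction.dualAnnihilator : Set (Module.Dual (ZMod 2) (V n)))).toFinset with hT
  have hTmem : ∀ f, f ∈ T ↔ f ∈ A.direction.dualAnnihilator := fun f => by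
    rw [hT, Set.Finite.mem_toFinset]; rfl
  have hsol : ∀ x : QReg n, Sol (eqsOf T a₀) x ↔ toV x ∈ A := by
    intro x
    rw [sol_eqsOf_iff, ← AffineSubspace.vsub_right_mem_direction_iff_mem ha₀ (toV x), vsub_eq_sub,
      ← Subspace.forall_mem_dualAnnihilator_apply_eq_zero_iff]
    refine ⟨fun h f hf => ?_, fun h f hf => ?_⟩
    · rw [map_sub, h f ((hTmem f).2 hf), sub_self]
    · have := h f ((hTmem f).1 hf)
      rwa [map_sub, sub_eq_zero] at this
  -- the vector in normal form
  set p : QReg n → ZMod 4 := fun x => lift (l (toV x)) + 2 * lift (quadFun c (toV x)) with hp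
  have hvec : affineQuadraticVector A l c = ddm (eqsOf T a₀) p 1 := by
    funext x
    rw [ddm_apply, one_mul]
    by_cases hx : toV x ∈ A
    · rw [if_pos ((hsol x).2 hx), affineQuadraticVector, if_pos hx, hp]
      dsimp only
      rw [phase_add, phase_lift, phase_two_mul_lift]
    · rw [if_neg (fun h => hx ((hsol x).1 h)), affineQuadraticVector, if_neg hx]
  obtain ⟨c', Ψ, hΨ, hc'⟩ := exists_smul_stabilizer_ddm (eqsOf T a₀) (isQF_lift_add_two_mul_lift l c)
  rw [← hvec] at hc'
  -- the scalar is non-zero since the vector is non-zero at `a₀`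
  have hne : c' ≠ 0 := by
    intro h0
    have h1 := congrFun hc' (ofV a₀)
    rw [h0, zero_smul, Pi.zero_apply, affineQuadraticVector, toV_ofV, if_pos ha₀'] at h1
    exact (mul_ne_zero (pow_ne_zero _ Complex.I_ne_zero) (pow_ne_zero _ (neg_ne_zero.2 one_ne_zero))) h1
  refine ⟨c'⁻¹, inv_ne_zero hne, ?_⟩
  rw [hc', smul_smul, inv_mul_cancel₀ hne, one_smul]
  exact hΨ

end StabilizerNormalForm

end Literature.Computability.QuantumComplexity
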